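import Literature.Probability.RandomPlanarGeometry.JordanIndexOne
import Literature.Probability.RandomPlanarGeometry.CrossRatioContinuity
import HarnessLib

/-!
# Two presentations of the same quad: orientation of the boundary loop and conformal modulus

Topic `Literature/Probability/RandomPlanarGeometry` (conformal rectangles = Jordan domains with
four marked boundary points, `PlanarDomains.lean`, `ConformalRectangle.lean`); theorems only.
A `JordanDomain` carries its boundary loop but no orientation, and a `ConformalRectangle` may be
re-presented (same carrier, another boundary loop, e.g. the transport `unitSquareQuad.map Φ` of
the model square by a square model `Φ`). This file compares two presentations `R`, `S` of the
same quad (`S.carrier = R.carrier`):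

* `ConformalRectangle.index_eq_index_of_pt_eq` — if the marked points agree, `S.pt i = R.pt i`,
  the two boundary loops have the same index (winding number) about every point off the
  frontier: by `JordanDomain.exists_lift` the loops differ by a circle homeomorphism `σ` of
  degree `±1` (`JordanDomain.index_eq_mul_index`), and `σ (S.mark i) ≡ R.mark i (mod 1)` with
  `0 ≤ mark 0 < mark 1 < mark 2 < mark 3 < 1` rules out degree `-1`;
* `ConformalRectangle.index_eq_neg_index_of_pt_swap` — if the marked points are related by the
  orientation-reversing relabelling `(0 1)(2 3)` (`S.pt 0 = R.pt 1`, `S.pt 1 = R.pt 0`,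
  `S.pt 2 = R.pt 3`, `S.pt 3 = R.pt 2`), the indices are opposite;
* `JordanDomain.exists_forall_index_eq_one` — **the orientation is stable**: if `D.index z₀ = 1`
  at a point `z₀ ∈ D`, every Jordan domain whose boundary loop is uniformly
  `dist (z₀, ∂D) / 2`-close to that of `D` has index `1` on its carrier (dog-on-leash,
  `JordanDomain.index_eq_index_of_dist_boundary_lt`,
  `JordanDomain.mem_carrier_of_dist_boundary_lt`);
* `ConformalRectangle.crossRatio_eq_crossRatio_of_pt` — the conformal modulus (Cardy
  cross-ratio of any uniformizing datum) of `S` equals that of `R` in both situations (read both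
  off one disc chart, `ConformalRectangle.ofReal_crossRatio_eq_cCrossRatio`; the complex
  cross-ratio is invariant under the Klein relabelling `(0 1)(2 3)`);
* `ConformalRectangle.tendsto_crossRatio_of_carrier_eq` — hence Radó's continuity of the modulus
  (`ConformalRectangle.tendsto_crossRatio_of_tendsto_mark`) along conformal rectangles whose
  boundary loops converge uniformly to that of `S` may be stated with the modulus of `R` as the
  limit.

## References

* L. V. Ahlfors, *Complex Analysis*, 3rd ed. (1979), Ch. 4 §2.1 (winding number), Ch. 3 §3.1
  (cross-ratio). [`AhlforsCA1979`]
* Ch. Pommerenke, *Boundary Behaviour of Conformal Maps* (1992), §2.3 Thm. 2.11 (Radó),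
  Thm. 2.6 (Carathéodory). [`PommerenkeBBCM1992`]

## Mathlib / tree

Tree: `JordanIndexOne.lean` (`exists_lift`, `index_eq_mul_index`, `exists_int_of_boundary_eq`),
`JordanIndex.lean` (`index_eq_of_mem_carrier`), `CrossRatioContinuity.lean`
(`index_eq_index_of_dist_boundary_lt`, `mem_carrier_of_dist_boundary_lt`,
`ofReal_crossRatio_eq_cCrossRatio`, `tendsto_crossRatio_of_tendsto_mark`),
`ConformalRectangleProofs.lean` (`MarkedDomain.exists_isUniformizing_holds`),
`ConformalMapRiemannProofs.lean` (`exists_conformalEquiv_ball_holds`),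
`ConformalMapCaratheodoryProofs.lean` (`JordanDomain.exists_continuousOn_extension_holds`).
Searched (`lean search`): `index_eq_index_of_pt`, `index_eq_neg`, `crossRatio_eq_crossRatio_of` —
no prior comparison of two presentations of a quad in the tree.
-/

noncomputable section

open Set Filter Metric Complex
open _root_.Topology
open UpperHalfPlane (upperHalfPlaneSet)

namespace Literature.Probability.RandomPlanarGeometry

/-! ### Stability of the orientation -/

namespace JordanDomain

/-- **The orientation of a Jordan domain is stable under uniform perturbation of the boundary
loop.** If `D.index z₀ = 1` at some `z₀ ∈ D`, there is `ε > 0` (half the distance from `z₀` to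
`∂D`) such that every Jordan domain `D'` whose boundary loop is pointwise `ε`-close to that of
`D` has index `1` at every point of its carrier: `z₀ ∈ D'` and `D'.index z₀ = D.index z₀`
(dog-on-leash), and the index is constant on `D'`. Ahlfors (1979), Ch. 4 §2.1. [folklore] -/
theorem exists_forall_index_eq_one (D : JordanDomain) {z₀ : ℂ} (hz₀ : z₀ ∈ D.carrier)
    (h1 : D.index z₀ = 1) :
    ∃ ε > 0, ∀ D' : JordanDomain, (∀ s, dist (D'.boundary s) (D.boundary s) ≤ ε) →
      ∀ z ∈ D'.carrier, D'.index z = 1 := by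
  have hpos := D.infDist_frontier_pos hz₀
  refine ⟨infDist z₀ (frontier D.carrier) / 2, half_pos hpos, fun D' hD' z hz => ?_⟩
  have hclose : ∀ t, dist (D'.boundary t) (D.boundary t) < infDist z₀ (frontier D.carrier) :=
    fun t => (hD' t).trans_lt (half_lt_self hpos)
  rw [D'.index_eq_of_mem_carrier hz (mem_carrier_of_dist_boundary_lt D D' hz₀ hclose),
    index_eq_index_of_dist_boundary_lt D D' hz₀ hclose, h1]

end JordanDomain

/-! ### Two presentations with the same (or pair-swapped) marked points -/

namespace ConformalRectangle

variable (R S : ConformalRectangle)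

/-- The marks of a conformal rectangle: `0 ≤ m₀ < m₁ < m₂ < m₃ < 1`. [folklore] -/
theorem mark_bounds : 0 ≤ R.mark 0 ∧ R.mark 0 < R.mark 1 ∧ R.mark 1 < R.mark 2 ∧
    R.mark 2 < R.mark 3 ∧ R.mark 3 < 1 :=
  ⟨(R.mark_mem 0).1, R.strictMono_mark (by decide), R.strictMono_mark (by decide),
    R.strictMono_mark (by decide), (R.mark_mem 3).2⟩

/-- If `σ` lifts the boundary loop of `S` through that of `R` on `[0, 1]` and the `i`-th marked
point of `S` is the `j`-th marked point of `R`, then `σ (S.mark i) ≡ R.mark j (mod 1)`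
(injectivity of `R.boundary` on a period). [folklore] -/
theorem exists_int_lift_mark {σ : ℝ → ℝ}
    (hσ : ∀ t ∈ Icc (0 : ℝ) 1, R.boundary (σ t) = S.boundary t) {i j : Fin 4}
    (h : S.pt i = R.pt j) : ∃ n : ℤ, σ (S.mark i) = R.mark j + n := by
  apply R.exists_int_of_boundary_eq
  rw [hσ _ (Ico_subset_Icc_self (S.mark_mem i))]
  exact h

/-- **Two presentations of a quad with the same marked points have the same orientation.** If
`S.carrier = R.carrier` and `S.pt i = R.pt i` for `i = 0, …, 3`, then `S.index z = R.index z`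
off the frontier. The loops differ by a circle homeomorphism `σ` of degree `±1`
(`JordanDomain.exists_lift`, `JordanDomain.index_eq_mul_index`); were `σ` decreasing, the
congruences `σ (S.mark i) ≡ R.mark i (mod 1)`, `i = 0, 1, 2`, would force
`R.mark 2 - R.mark 0 > 1`. Ahlfors (1979), Ch. 4 §2.1. [folklore] -/
theorem index_eq_index_of_pt_eq (hc : S.carrier = R.carrier) (hpt : ∀ i, S.pt i = R.pt i)
    {z : ℂ} (hz : z ∉ frontier R.carrier) : S.index z = R.index z := by
  obtain ⟨σ, hσc, hσ, hcase⟩ := JordanDomain.exists_lift S.toJordanDomain R.toJordanDomain hc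
  rcases hcase with ⟨-, h1⟩ | ⟨hanti, hper⟩
  · simpa using JordanDomain.index_eq_mul_index S.toJordanDomain R.toJordanDomain hσc hσ
      (n := 1) (by rw [h1]; simp) hz
  · exfalso
    obtain ⟨n0, e0⟩ := exists_int_lift_mark R S hσ (hpt 0)
    obtain ⟨n1, e1⟩ := exists_int_lift_mark R S hσ (hpt 1)
    obtain ⟨n2, e2⟩ := exists_int_lift_mark R S hσ (hpt 2)
    obtain ⟨a0, a01, a12, a23, a3⟩ := R.mark_bounds
    obtain ⟨b0, b01, b12, b23, b3⟩ := S.mark_bounds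
    have hI : ∀ i, S.mark i ∈ Icc (0 : ℝ) 1 := fun i => Ico_subset_Icc_self (S.mark_mem i)
    have h01 : σ (S.mark 1) < σ (S.mark 0) := hanti (hI 0) (hI 1) b01
    have h12 : σ (S.mark 2) < σ (S.mark 1) := hanti (hI 1) (hI 2) b12
    have h2 : σ 1 < σ (S.mark 2) := hanti (hI 2) ⟨zero_le_one, le_rfl⟩ (by linarith)
    have h0 : σ (S.mark 0) ≤ σ 0 := hanti.antitoneOn ⟨le_rfl, zero_le_one⟩ (hI 0) b0
    rw [e0, e1] at h01
    rw [e1, e2] at h12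
    rw [e2, hper] at h2
    rw [e0] at h0
    have i1 : n1 < n0 := by exact_mod_cast (by linarith : (n1 : ℝ) < n0)
    have i2 : n2 < n1 := by exact_mod_cast (by linarith : (n2 : ℝ) < n1)
    have i3 : (n2 : ℝ) + 2 ≤ n0 := by exact_mod_cast (by omega : n2 + 2 ≤ n0)
    linarith

/-- **Two presentations of a quad whose marked points are related by the relabelling
`(0 1)(2 3)` have opposite orientations.** If `S.carrier = R.carrier` and `S.pt 0 = R.pt 1`,
`S.pt 1 = R.pt 0`, `S.pt 2 = R.pt 3`, `S.pt 3 = R.pt 2`, then `S.index z = -R.index z` off the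
frontier: were the lift `σ` of `JordanDomain.exists_lift` increasing, the four congruences
`σ (S.mark i) ≡ R.mark (π i) (mod 1)` would be incompatible with `σ 1 = σ 0 + 1`.
Ahlfors (1979), Ch. 4 §2.1. [folklore] -/
theorem index_eq_neg_index_of_pt_swap (hc : S.carrier = R.carrier) (h0 : S.pt 0 = R.pt 1)
    (h1 : S.pt 1 = R.pt 0) (h2 : S.pt 2 = R.pt 3) (h3 : S.pt 3 = R.pt 2)
    {z : ℂ} (hz : z ∉ frontier R.carrier) : S.index z = -R.index z := by
  obtain ⟨σ, hσc, hσ, hcase⟩ := JordanDomain.exists_lift S.toJordanDomain R.toJordanDomain hc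
  rcases hcase with ⟨hmono, hper⟩ | ⟨-, hper⟩
  · exfalso
    obtain ⟨n0, e0⟩ := exists_int_lift_mark R S hσ h0
    obtain ⟨n1, e1⟩ := exists_int_lift_mark R S hσ h1
    obtain ⟨n2, e2⟩ := exists_int_lift_mark R S hσ h2
    obtain ⟨n3, e3⟩ := exists_int_lift_mark R S hσ h3
    obtain ⟨a0, a01, a12, a23, a3⟩ := R.mark_bounds
    obtain ⟨b0, b01, b12, b23, b3⟩ := S.mark_bounds
    have hI : ∀ i, S.mark i ∈ Icc (0 : ℝ) 1 := fun i => Ico_subset_Icc_self (S.mark_mem i)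
    have k01 : σ (S.mark 0) < σ (S.mark 1) := hmono (hI 0) (hI 1) b01
    have k12 : σ (S.mark 1) < σ (S.mark 2) := hmono (hI 1) (hI 2) b12
    have k23 : σ (S.mark 2) < σ (S.mark 3) := hmono (hI 2) (hI 3) b23
    have k3 : σ (S.mark 3) < σ 1 := hmono (hI 3) ⟨zero_le_one, le_rfl⟩ b3
    have k0 : σ 0 ≤ σ (S.mark 0) := hmono.monotoneOn ⟨le_rfl, zero_le_one⟩ (hI 0) b0
    rw [e0, e1] at k01
    rw [e1, e2] at k12
    rw [e2, e3] at k23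
    rw [e3, hper] at k3
    rw [e0] at k0
    have i1 : n0 < n1 := by exact_mod_cast (by linarith : (n0 : ℝ) < n1)
    have i2 : n1 < n2 + 1 := by exact_mod_cast (by linarith : (n1 : ℝ) < n2 + 1)
    have i3 : n2 < n3 := by exact_mod_cast (by linarith : (n2 : ℝ) < n3)
    have i4 : n3 < n0 + 1 := by exact_mod_cast (by linarith : (n3 : ℝ) < n0 + 1)
    omega
  · simpa using JordanDomain.index_eq_mul_index S.toJordanDomain R.toJordanDomain hσc hσ
      (n := -1) (by rw [hper]; simp [sub_eq_add_neg]) hz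

/-! ### The modulus of two presentations -/

/-- **Two presentations of a quad with the same marked points, or with marked points related by
the relabelling `(0 1)(2 3)`, have the same conformal modulus**, for arbitrary uniformizing data
on both sides. Both cross-ratios are read off one disc chart of the common carrier
(`ofReal_crossRatio_eq_cCrossRatio`: Riemann map, Carathéodory extension, circle preimages `ζ i`
of the marked points), and the complex cross-ratio of `(ζ₁, ζ₀, ζ₃, ζ₂)` is that of
`(ζ₀, ζ₁, ζ₂, ζ₃)`. Ahlfors (1979), Ch. 3 §3.1; Pommerenke (1992), §2.3 Exercise 2. [folklore] -/
theorem crossRatio_eq_crossRatio_of_pt (hc : S.carrier = R.carrier)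
    (hpt : (∀ i, S.pt i = R.pt i) ∨
      (S.pt 0 = R.pt 1 ∧ S.pt 1 = R.pt 0 ∧ S.pt 2 = R.pt 3 ∧ S.pt 3 = R.pt 2))
    {φ' : ConformalEquiv upperHalfPlaneSet S.carrier} {x' : Fin 4 → ℝ}
    (hφ' : S.IsUniformizing φ' x') {φ : ConformalEquiv upperHalfPlaneSet R.carrier}
    {x : Fin 4 → ℝ} (hφ : R.IsUniformizing φ x) : crossRatio x' = crossRatio x := by
  -- make the two carriers definitionally equal
  obtain ⟨⟨c, b, ho, hbd, hconn, hb, hper, hinj, hrange⟩, m, hm, hmem⟩ := S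
  change c = R.carrier at hc
  subst hc
  set S : ConformalRectangle := ⟨⟨R.carrier, b, ho, hbd, hconn, hb, hper, hinj, hrange⟩, m, hm,
    hmem⟩ with hS
  -- a disc chart of the common carrier and its Carathéodory extension
  obtain ⟨f₀⟩ := exists_conformalEquiv_ball_holds (U := R.carrier) R.isOpen
    R.isSimplyConnected_carrier R.carrier_ne_univ
  obtain ⟨Φ, hΦc, hΦeq, hΦbij, hΦsph⟩ :=
    JordanDomain.exists_continuousOn_extension_holds R.toJordanDomain f₀.symm
  have hcorner : ∀ i, ∃ ζ ∈ sphere (0 : ℂ) 1, Φ ζ = R.pt i := fun i ↦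
    hΦsph.surjOn (R.pt_mem_frontier i)
  choose ζ hζs hΦζ using hcorner
  have hζ : ∀ i, ζ i ∈ closedBall (0 : ℂ) 1 := fun i ↦ sphere_subset_closedBall (hζs i)
  have hx : (crossRatio x : ℂ) = cCrossRatio ζ :=
    R.ofReal_crossRatio_eq_cCrossRatio f₀.symm hΦc hΦeq hΦbij.injOn hζ hΦζ hφ
  have hx' : (crossRatio x' : ℂ) = cCrossRatio ζ := by
    rcases hpt with hpt | ⟨h0, h1, h2, h3⟩
    · exact S.ofReal_crossRatio_eq_cCrossRatio f₀.symm hΦc hΦeq hΦbij.injOn hζ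
        (fun i ↦ (hΦζ i).trans (hpt i).symm) hφ'
    · have hζ' : ∀ i, (![ζ 1, ζ 0, ζ 3, ζ 2] : Fin 4 → ℂ) i ∈ closedBall (0 : ℂ) 1 := by
        intro i; fin_cases i <;> simp [hζ]
      have hΦζ' : ∀ i, Φ ((![ζ 1, ζ 0, ζ 3, ζ 2] : Fin 4 → ℂ) i) = S.pt i := by
        intro i
        fin_cases i
        · simpa [h0] using hΦζ 1
        · simpa [h1] using hΦζ 0
        · simpa [h2] using hΦζ 3
        · simpa [h3] using hΦζ 2
      rw [S.ofReal_crossRatio_eq_cCrossRatio f₀.symm hΦc hΦeq hΦbij.injOn hζ' hΦζ' hφ']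
      simp only [cCrossRatio, Matrix.cons_val_zero, Matrix.cons_val_one, Matrix.cons_val]
      ring
  exact_mod_cast hx'.trans hx.symm

/-- **Radó's continuity of the modulus, with a re-presented limit.** Let `S` be a presentation
of the quad `R` (same carrier; marked points equal, or related by the relabelling `(0 1)(2 3)`).
If the boundary loops of the conformal rectangles `Q n` converge uniformly to the boundary loop
of `S` and their marks are those of `S`, then for any uniformizing data `(ψ n, y n)` of `Q n` and
`(φ, x)` of `R`, `crossRatio (y n) → crossRatio x`
(`tendsto_crossRatio_of_tendsto_mark` towards a uniformizing datum of `S`, which exists by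
`MarkedDomain.exists_isUniformizing_holds`, and `crossRatio_eq_crossRatio_of_pt`).
Pommerenke (1992), §2.3 Thm. 2.11. [folklore] -/
theorem tendsto_crossRatio_of_carrier_eq (hc : S.carrier = R.carrier)
    (hpt : (∀ i, S.pt i = R.pt i) ∨
      (S.pt 0 = R.pt 1 ∧ S.pt 1 = R.pt 0 ∧ S.pt 2 = R.pt 3 ∧ S.pt 3 = R.pt 2))
    {Q : ℕ → ConformalRectangle}
    (hJ : TendstoUniformly (fun n ↦ (Q n).boundary) S.boundary atTop)
    (hmk : ∀ n i, (Q n).mark i = S.mark i)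
    (ψ : ∀ n, ConformalEquiv upperHalfPlaneSet (Q n).carrier) (y : ℕ → Fin 4 → ℝ)
    (hψ : ∀ n, (Q n).IsUniformizing (ψ n) (y n))
    (φ : ConformalEquiv upperHalfPlaneSet R.carrier) (x : Fin 4 → ℝ) (hφ : R.IsUniformizing φ x) :
    Tendsto (fun n ↦ crossRatio (y n)) atTop (𝓝 (crossRatio x)) := by
  obtain ⟨φ', x', hφ'⟩ := MarkedDomain.exists_isUniformizing_holds S
  have hlim := tendsto_crossRatio_of_tendsto_mark hJ
    (fun i ↦ tendsto_const_nhds.congr fun n ↦ (hmk n i).symm) ψ y hψ φ' x' hφ'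
  rwa [crossRatio_eq_crossRatio_of_pt R S hc hpt hφ' hφ] at hlim

end ConformalRectangle

end Literature.Probability.RandomPlanarGeometry

end
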